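import Mathlib.RingTheory.AlgebraicIndependent.TranscendenceBasis
import Mathlib.LinearAlgebra.Eigenspace.Triangularizable
import Literature.Computability.AlgebraicComplexity.BI17FundamentalInvariantForms
import Literature.Computability.AlgebraicComplexity.Poonen05HypersurfaceLinearAutomorphisms
import Literature.Computability.AlgebraicComplexity.BinarySemiInvariants
import HarnessLib

/-!
# Bürgisser–Ikenmeyer 2017, App. Prop. 7.4 (3): generic binary forms of degree `D ≥ 5` have a
# trivial stabilizer — proofs

Theorem-only companion (cell `val-lit`, row BI2017-A; no definitions, no named facts) of the file of
record `BI17FundamentalInvariantForms.lean`, which types P. Bürgisser, C. Ikenmeyer, *Fundamental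
invariants of orbit closures*, J. Algebra 477 (2017), Appendix (= arXiv §7) Prop. 7.4 as the named
fact `BI2017_prop_A_4`. Its third clause (main.tex L2933–2934, held text p0026:L68): "3. Let `D ≥ 5`.
The stabilizer of a generic `w ∈ Sym^D ℂ²` is trivial, hence `a'(D,2) = 1`." — whose proof the
source omits — is PROVED here (`BI2017_prop_A_4_part3`). Clauses 1–2 (`D = 3, 4`: `a(3,2) = 6`,
`a(4,2) = 2`) are not treated; the named fact stays open.

## Proof (elementary; no roots of binary forms, no invariant theory)

* (§2) A non-scalar `g ∈ GL₂(ℂ)` stabilizing a form `f` of degree `D` is conjugate (`g P = P T`,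
  `P` invertible, by an eigenvector of `g`) to an upper triangular `T = (λ b; 0 μ)` with either
  `λ ≠ μ`, `b = 0` or `λ = μ`, `b ≠ 0`; the form `f̃ = P⁻¹ · f` is stabilized by `T`
  (column convention of the tree's `linSubst`: `x_i ↦ ∑_j T_{ji} x_j`).
* (§3) If `T` is diagonal with `λ ≠ μ`, comparing coefficients gives `λ^a μ^{D-a} = 1` on the support
  of `f̃ = ∑ c_a x₀^a x₁^{D-a}`, so `λ/μ` is a root of unity of some order `n` with `2 ≤ n ≤ D`
  dividing all differences of `x₀`-exponents: `supp f̃ ⊆ r + nℤ` ("lacunary"), or `f̃` is a monomial.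
  If `T = (λ b; 0 λ)`, `b ≠ 0`, the two lowest `x₀`-coefficients of `T · f̃ = f̃` (binomial
  expansion, the tree's `coeff_binIdx_linSubst_monomial`) force `f̃ = c x₀^D`.
* (§4) Hence `f = P · f̃` lies in the image of one of finitely many polynomial maps
  `(t₀, t₁, c) ↦ ∑_j c_j u^{r+nj} v^{D-r-nj}` (`u, v` the two columns of `P` normalised in one of four
  affine charts), each with at most `⌊D/2⌋ + 3 ≤ D < D + 1 = dim Sym^D ℂ²` parameters.
* (§1) The image of a polynomial map `𝔸^a → 𝔸^N` with `a < N` lies in a hypersurface `{P = 0}`,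
  `P ≠ 0`: the `N` coordinate functions cannot be algebraically independent in `ℂ[t_1, …, t_a]`
  (Mathlib's transcendence degree, `MvPolynomial.trdeg_of_isDomain`). The product of these `P` is
  the genericity polynomial; off its zero set every stabilizer element is a scalar `ζ I`, and
  `ζ^D = 1` since `f ≠ 0`; `a'(w) = 1` then follows from the tree's
  `reducedStabilizerPeriod_eq_one_of_hasTrivialStabilizer` (x3's Poonen file).

Honest framing: bookkeeping of a printed statement about binary forms; nothing here bears on VP
versus VNP.

## References

* [BurgisserIkenmeyer2017] P. Bürgisser, C. Ikenmeyer, J. Algebra 477 (2017) 390–434 =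
  arXiv:1511.02927, Appendix Prop. 7.4 (3) (main.tex L2925–2934).

## Tree

`linSubst`, `linSubst_X`, `linSubst_mul`, `linSubst_one` (`LinSubst`); `linStabilizer`,
`mem_linStabilizer` (`EquivariantDC`); `HasTrivialStabilizer`, `IsZariskiGeneric`,
`reducedStabilizerPeriod` (`BI17FundamentalInvariantForms`);
`reducedStabilizerPeriod_eq_one_of_hasTrivialStabilizer` (`Poonen05HypersurfaceLinearAutomorphisms`);
`binIdx`, `binIdxEquiv`, `degIdx_fin_two_add`, `coeff_binIdx_linSubst_monomial`
(`BinarySemiInvariants`); `formCoeff`, `DegIdx` (`OrbitCoordinateRing`). Mathlib: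
`AlgebraicIndependent.cardinalMk_le_trdeg`, `MvPolynomial.trdeg_of_isDomain`,
`Module.End.exists_eigenvalue`, `Matrix.det_fin_two`, `orderOf_dvd_of_pow_eq_one`.
-/

noncomputable section

open MvPolynomial
open scoped BigOperators

namespace Literature.Computability.AlgebraicComplexity

/-! ### §1 Images of polynomial maps with few parameters lie in hypersurfaces -/

section Hypersurface

/-- **A polynomial family of forms with fewer parameters than `dim Sym^D` misses a hypersurface.**
If `G` is a form in `m` variables whose coefficients are polynomials in `a` parameters and
`a < #{monomials of degree D}`, then there is a nonzero polynomial `P` in the degree-`D`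
coefficients vanishing at every specialisation `G(t)`, `t ∈ ℂ^a`: the coefficient functions are
`> a` elements of `ℂ[t_1, …, t_a]`, which has transcendence degree `a`, so they are algebraically
dependent. (Standard dimension count; used for BI 2017 App. Prop. 7.4 (3).)
[cite: BurgisserIkenmeyer2017, §7 (Appendix) Prop. 7.4 (3)] -/
theorem exists_ne_zero_aeval_formCoeff_map_eq_zero {a m D : ℕ}
    (ha : a < Fintype.card (DegIdx (Fin m) D))
    (G : MvPolynomial (Fin m) (MvPolynomial (Fin a) ℂ)) :
    ∃ P : MvPolynomial (DegIdx (Fin m) D) ℂ, P ≠ 0 ∧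
      ∀ t : Fin a → ℂ, aeval (formCoeff D (MvPolynomial.map (MvPolynomial.eval t) G)) P = 0 := by
  classical
  let x : DegIdx (Fin m) D → MvPolynomial (Fin a) ℂ := fun e => coeff e.1 G
  have ha' : a < (degMonomials (Fin m) D).card := by rwa [← Fintype.card_coe]
  have hx : ¬ AlgebraicIndependent ℂ x := by
    intro h
    have h1 := h.cardinalMk_le_trdeg
    rw [MvPolynomial.trdeg_of_isDomain, Cardinal.mk_fintype, Cardinal.mk_fintype,
      Fintype.card_fin, Fintype.card_coe] at h1
    norm_num at h1
    omega
  have hx' : ¬ Function.Injective (aeval x : MvPolynomial (DegIdx (Fin m) D) ℂ →ₐ[ℂ] _) := hx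
  rw [injective_iff_map_eq_zero] at hx'
  push Not at hx'
  obtain ⟨P, hP0, hPne⟩ := hx'
  refine ⟨P, hPne, fun t => ?_⟩
  have hpt : formCoeff D (MvPolynomial.map (MvPolynomial.eval t) G) =
      fun e => MvPolynomial.aeval t (x e) := by
    funext e
    rw [formCoeff_apply, coeff_map]
    rfl
  rw [hpt, ← MvPolynomial.comp_aeval, AlgHom.comp_apply, hP0, map_zero]

/-- `dim Sym^D ℂ² = D + 1` (the monomials `x₀^p x₁^{D-p}`, `0 ≤ p ≤ D`). (Step of the proof of BI 2017 App. Prop. 7.4 (3) given here; the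
source omits that proof.) [cite: BurgisserIkenmeyer2017, §7 (Appendix) Prop. 7.4 (3)] -/
theorem card_degIdx_fin_two (D : ℕ) : Fintype.card (DegIdx (Fin 2) D) = D + 1 := by
  rw [← Fintype.card_congr (binIdxEquiv D), Fintype.card_fin]

end Hypersurface

/-! ### §2 Coefficients of binary forms and diagonal substitutions -/

section Coefficients

variable {D : ℕ}

/-- A degree-`D` exponent in two variables is `x₀^{e₀} x₁^{D - e₀}`. (Step of the proof of BI 2017 App. Prop. 7.4 (3) given here; the
source omits that proof.) [cite: BurgisserIkenmeyer2017, §7 (Appendix) Prop. 7.4 (3)] -/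
theorem eq_binIdx_of_degree {e : Fin 2 →₀ ℕ} (he : e.degree = D) : e = (binIdx D (e 0)).1 := by
  have h := eq_binIdx (⟨e, mem_degMonomials_iff.mpr he⟩ : DegIdx (Fin 2) D)
  exact congrArg Subtype.val h

/-- **Expansion of a binary form along `x₀^p x₁^{D-p}`**: a form of degree `D` in two variables is
`∑_{p ≤ D} c_p x₀^p x₁^{D-p}` with `c_p` its coefficients. (Step of the proof of BI 2017 App. Prop. 7.4 (3) given here; the
source omits that proof.) [cite: BurgisserIkenmeyer2017, §7 (Appendix) Prop. 7.4 (3)] -/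
theorem eq_sum_monomial_binIdx {f : MvPolynomial (Fin 2) ℂ} (hf : f.IsHomogeneous D) :
    f = ∑ p ∈ Finset.range (D + 1), monomial (binIdx D p).1 (coeff (binIdx D p).1 f) := by
  classical
  have hinj : Set.InjOn (fun p => (binIdx D p).1) (Finset.range (D + 1) : Set ℕ) := by
    intro p hp q hq h
    have h0 := congrArg (fun e : Fin 2 →₀ ℕ => e 0) h
    simp only [binIdx_apply_zero] at h0
    rw [Finset.coe_range, Set.mem_Iio] at hp hq
    omega
  have himg : ∑ p ∈ Finset.range (D + 1), monomial (binIdx D p).1 (coeff (binIdx D p).1 f) =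
      ∑ e ∈ (Finset.range (D + 1)).image (fun p => (binIdx D p).1), monomial e (coeff e f) := by
    rw [Finset.sum_image hinj]
  rw [himg]
  conv_lhs => rw [f.as_sum]
  apply Finset.sum_subset
  · intro e he
    have hdeg : e.degree = D := by
      rw [Finsupp.degree_eq_weight_one]
      exact hf (mem_support_iff.mp he)
    rw [Finset.mem_image]
    refine ⟨e 0, ?_, (eq_binIdx_of_degree hdeg).symm⟩
    rw [Finset.mem_range, Nat.lt_succ_iff]
    have := degIdx_fin_two_add D ⟨e, mem_degMonomials_iff.mpr hdeg⟩
    change e 0 + e 1 = D at this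
    omega
  · intro e _ he
    rw [notMem_support_iff.mp he, monomial_zero]

/-- Coefficients of a diagonal substitution of a binary form: `coeff_e (diag(β) · f) =
β₀^{e₀} β₁^{e₁} coeff_e f`. (Step of the proof of BI 2017 App. Prop. 7.4 (3) given here; the
source omits that proof.) [cite: BurgisserIkenmeyer2017, §7 (Appendix) Prop. 7.4 (3)] -/
theorem coeff_linSubst_diagonal_fin_two (β : Fin 2 → ℂ) (f : MvPolynomial (Fin 2) ℂ)
    (e : Fin 2 →₀ ℕ) :
    coeff e (linSubst (Fin 2) ℂ (Matrix.diagonal β) f) = (β 0 ^ e 0 * β 1 ^ e 1) * coeff e f := by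
  classical
  conv_lhs => rw [f.as_sum, map_sum]
  simp only [linSubst_diagonal_monomial, coeff_sum, coeff_smul, coeff_monomial, smul_eq_mul]
  rw [Finset.sum_eq_single e]
  · rw [if_pos rfl, Finsupp.prod_fintype _ _ (fun i => pow_zero _), Fin.prod_univ_two]
  · intro e' _ hne
    rw [if_neg hne, mul_zero]
  · intro he
    rw [notMem_support_iff.mp he, if_pos rfl, mul_zero]

/-- Scalar matrices act on forms of degree `D` by `c^D`. (Step of the proof of BI 2017 App. Prop. 7.4 (3) given here; the
source omits that proof.) [cite: BurgisserIkenmeyer2017, §7 (Appendix) Prop. 7.4 (3)] -/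
theorem linSubst_smul_one_fin_two {D : ℕ} {f : MvPolynomial (Fin 2) ℂ} (hf : f.IsHomogeneous D)
    (c : ℂ) : linSubst (Fin 2) ℂ (c • (1 : Matrix (Fin 2) (Fin 2) ℂ)) f = c ^ D • f := by
  classical
  have h1 : c • (1 : Matrix (Fin 2) (Fin 2) ℂ) = Matrix.diagonal fun _ => c := by
    ext i j
    by_cases hij : i = j
    · subst hij; simp
    · simp [Matrix.one_apply_ne hij, Matrix.diagonal_apply_ne _ hij]
  rw [h1]
  ext e
  rw [coeff_linSubst_diagonal_fin_two, coeff_smul, smul_eq_mul]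
  by_cases he : e ∈ f.support
  · have hdeg : e 0 + e 1 = D := by
      have hd : e.degree = D := by
        rw [Finsupp.degree_eq_weight_one]
        exact hf (mem_support_iff.mp he)
      exact degIdx_fin_two_add D ⟨e, mem_degMonomials_iff.mpr hd⟩
    rw [← pow_add, hdeg]
  · rw [notMem_support_iff.mp he, mul_zero, mul_zero]

/-- **Coefficients of an upper triangular substitution of a binary form** along
`x₀^p x₁^{D-p}`, from the binomial expansion `coeff_binIdx_linSubst_monomial`. (Step of the proof of BI 2017 App. Prop. 7.4 (3) given here; the
source omits that proof.) [cite: BurgisserIkenmeyer2017, §7 (Appendix) Prop. 7.4 (3)] -/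
theorem coeff_binIdx_linSubst_of_upper {D : ℕ} {f : MvPolynomial (Fin 2) ℂ}
    (hf : f.IsHomogeneous D) (β : Matrix (Fin 2) (Fin 2) ℂ) (hβ : β 1 0 = 0) {p : ℕ} (hp : p ≤ D) :
    coeff (binIdx D p).1 (linSubst (Fin 2) ℂ β f) =
      ∑ q ∈ Finset.range (D + 1), coeff (binIdx D q).1 f *
        (if q ≤ p then (((D - q).choose (p - q) : ℕ) : ℂ) * β 0 0 ^ q * β 0 1 ^ (p - q) *
          β 1 1 ^ (D - p) else 0) := by
  classical
  conv_lhs => rw [eq_sum_monomial_binIdx hf, map_sum, coeff_sum]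
  refine Finset.sum_congr rfl fun q hq => ?_
  rw [Finset.mem_range, Nat.lt_succ_iff] at hq
  have hmon : monomial (binIdx D q).1 (coeff (binIdx D q).1 f) =
      C (coeff (binIdx D q).1 f) * monomial (binIdx D q).1 1 := by
    rw [C_mul_monomial, mul_one]
  rw [hmon, map_mul, linSubst_C, coeff_C_mul,
    coeff_binIdx_linSubst_monomial β hβ _ (degIdx_fin_two_add D _) hp, binIdx_apply_zero,
    binIdx_apply_one, min_eq_left hq]

end Coefficients

/-! ### §3 Triangularising a non-scalar `2 × 2` matrix by an eigenvector -/

section Triangular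

/-- **Eigenvector triangularisation of a non-scalar `2 × 2` complex matrix**: there is an invertible
`P` with `g P = P T`, `T = (λ b; 0 μ)` upper triangular, and either `λ ≠ μ`, `b = 0` (two distinct
eigenvalues: `g` is diagonalised) or `λ = μ`, `b ≠ 0` (a Jordan block). (Step of the proof of BI 2017 App. Prop. 7.4 (3) given here; the
source omits that proof.) [cite: BurgisserIkenmeyer2017, §7 (Appendix) Prop. 7.4 (3)] -/
theorem exists_mul_eq_mul_upperTriangular (g : Matrix (Fin 2) (Fin 2) ℂ)
    (hns : ∀ c : ℂ, g ≠ c • (1 : Matrix (Fin 2) (Fin 2) ℂ)) :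
    ∃ (P : Matrix (Fin 2) (Fin 2) ℂ) (l μ b : ℂ), P.det ≠ 0 ∧ g * P = P * !![l, b; 0, μ] ∧
      (l = μ → b ≠ 0) ∧ (l ≠ μ → b = 0) := by
  -- an eigenvector `v` of `g`, eigenvalue `l`
  obtain ⟨l, hl⟩ := Module.End.exists_eigenvalue (Matrix.toLin' g)
  obtain ⟨v, hv⟩ := hl.exists_hasEigenvector
  have hgv : g.mulVec v = l • v := by
    have := Module.End.mem_eigenspace_iff.mp hv.1
    rwa [Matrix.toLin'_apply] at this
  have hv0 : v ≠ 0 := hv.2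
  have h0 : g 0 0 * v 0 + g 0 1 * v 1 = l * v 0 := by
    have := congrFun hgv 0
    simpa [Matrix.mulVec, dotProduct, Fin.sum_univ_two] using this
  have h1 : g 1 0 * v 0 + g 1 1 * v 1 = l * v 1 := by
    have := congrFun hgv 1
    simpa [Matrix.mulVec, dotProduct, Fin.sum_univ_two] using this
  -- first triangularisation `g P₀ = P₀ T₀`
  obtain ⟨P₀, b₀, μ, hP₀, hT₀⟩ : ∃ (P₀ : Matrix (Fin 2) (Fin 2) ℂ) (b₀ μ : ℂ), P₀.det ≠ 0 ∧
      g * P₀ = P₀ * !![l, b₀; 0, μ] := by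
    by_cases hv₀ : v 0 = 0
    · have hv₁ : v 1 ≠ 0 := by
        intro h
        apply hv0
        funext i
        fin_cases i
        · exact hv₀
        · exact h
      rw [hv₀, mul_zero, zero_add, mul_zero] at h0
      rw [hv₀, mul_zero, zero_add] at h1
      have hq : g 0 1 = 0 := (mul_eq_zero.mp h0).resolve_right hv₁
      have hs : g 1 1 = l := mul_right_cancel₀ hv₁ h1
      refine ⟨!![0, 1; 1, 0], g 1 0, g 0 0, by simp [Matrix.det_fin_two_of], ?_⟩
      ext i j
      fin_cases i <;> fin_cases j <;>
        simp [Matrix.mul_apply, Fin.sum_univ_two, hq, hs]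
    · set s : ℂ := v 1 / v 0 with hs_def
      have hv1 : v 1 = s * v 0 := by rw [hs_def, div_mul_cancel₀ _ hv₀]
      have h0' : g 0 0 + g 0 1 * s = l := by
        apply mul_right_cancel₀ hv₀
        rw [add_mul, mul_assoc, ← hv1, h0]
      have h1' : g 1 0 + g 1 1 * s = l * s := by
        apply mul_right_cancel₀ hv₀
        rw [add_mul, mul_assoc, ← hv1, h1, hv1, mul_assoc]
      refine ⟨!![1, 0; s, 1], g 0 1, g 1 1 - s * g 0 1, by simp [Matrix.det_fin_two_of], ?_⟩
      ext i j
      fin_cases i <;> fin_cases j <;>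
        simp [Matrix.mul_apply, Fin.sum_univ_two] <;>
        first
          | linear_combination h0'
          | linear_combination h1'
  have hP₀u : IsUnit P₀.det := isUnit_iff_ne_zero.mpr hP₀
  by_cases hlμ : l = μ
  · -- Jordan case: `b₀ ≠ 0`, else `g` would be scalar
    refine ⟨P₀, l, μ, b₀, hP₀, hT₀, fun _ hb => ?_, fun h => absurd hlμ h⟩
    apply hns l
    have hT : !![l, b₀; 0, μ] = l • (1 : Matrix (Fin 2) (Fin 2) ℂ) := by
      rw [hb, ← hlμ]
      ext i j
      fin_cases i <;> fin_cases j <;> simp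
    calc g = g * P₀ * P₀⁻¹ := by rw [Matrix.mul_assoc, Matrix.mul_nonsing_inv _ hP₀u, Matrix.mul_one]
      _ = l • (1 : Matrix (Fin 2) (Fin 2) ℂ) := by
        rw [hT₀, hT, Matrix.mul_smul, Matrix.mul_one, Matrix.smul_mul,
          Matrix.mul_nonsing_inv _ hP₀u]
  · -- two distinct eigenvalues: diagonalise with the second eigenvector `(b₀, μ - l)` of `T₀`
    refine ⟨P₀ * !![1, b₀; 0, μ - l], l, μ, 0, ?_, ?_, fun h => absurd h hlμ, fun _ => rfl⟩
    · rw [Matrix.det_mul, Matrix.det_fin_two_of]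
      refine mul_ne_zero hP₀ ?_
      have : μ - l ≠ 0 := sub_ne_zero.mpr (Ne.symm hlμ)
      simpa using this
    · have hTM : !![l, b₀; 0, μ] * !![1, b₀; 0, μ - l] =
          !![1, b₀; 0, μ - l] * !![l, (0 : ℂ); 0, μ] := by
        ext i j
        fin_cases i <;> fin_cases j <;> simp [Matrix.mul_apply, Fin.sum_univ_two] <;> ring
      rw [← Matrix.mul_assoc, hT₀, Matrix.mul_assoc, Matrix.mul_assoc, hTM]

/-- **Transfer of a stabilizer element along `g P = P T`**: if `g · f = f` then `T` stabilizes
`f̃ = P⁻¹ · f` and `f = P · f̃` (column convention `x_i ↦ ∑_j A_{ji} x_j`, `(AB) · f = A · (B · f)`).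
(Step of the proof of BI 2017 App. Prop. 7.4 (3) given here; the
source omits that proof.) [cite: BurgisserIkenmeyer2017, §7 (Appendix) Prop. 7.4 (3)] -/
theorem linSubst_inv_of_mul_eq_mul {g P T : Matrix (Fin 2) (Fin 2) ℂ} (hP : P.det ≠ 0)
    (hgP : g * P = P * T) {f : MvPolynomial (Fin 2) ℂ} (hgf : linSubst (Fin 2) ℂ g f = f) :
    linSubst (Fin 2) ℂ T (linSubst (Fin 2) ℂ P⁻¹ f) = linSubst (Fin 2) ℂ P⁻¹ f ∧
      linSubst (Fin 2) ℂ P (linSubst (Fin 2) ℂ P⁻¹ f) = f := by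
  have hPu : IsUnit P.det := isUnit_iff_ne_zero.mpr hP
  have hTP : T * P⁻¹ = P⁻¹ * g := by
    calc T * P⁻¹ = P⁻¹ * P * T * P⁻¹ := by rw [Matrix.nonsing_inv_mul _ hPu, Matrix.one_mul]
      _ = P⁻¹ * (g * P) * P⁻¹ := by rw [Matrix.mul_assoc P⁻¹ P T, ← hgP]
      _ = P⁻¹ * g := by rw [Matrix.mul_assoc, Matrix.mul_assoc, Matrix.mul_nonsing_inv _ hPu,
          Matrix.mul_one]
  constructor
  · rw [← AlgHom.comp_apply, ← linSubst_mul, hTP, linSubst_mul, AlgHom.comp_apply, hgf]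
  · rw [← AlgHom.comp_apply, ← linSubst_mul, Matrix.mul_nonsing_inv _ hPu, linSubst_one,
      AlgHom.id_apply]

end Triangular

/-! ### §4 A triangular stabilizer element makes the form lacunary -/

section Lacunary

variable {D : ℕ}

/-- **Diagonal stabilizer ⇒ lacunary support.** If `diag(λ, μ) · f = f` with `λ ≠ μ` (both
nonzero) for a binary form `f` of degree `D ≥ 2`, then `λ^a μ^{D-a} = 1` on the support, so
`λ/μ` is a root of unity whose order `n ∈ [2, D]` divides all differences of `x₀`-exponents:
all `x₀`-exponents of `f` are `≡ r (mod n)` for some `r < n` (for a monomial `f` take `n = 2`).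
(Step of the proof of BI 2017 App. Prop. 7.4 (3) given here; the
source omits that proof.) [cite: BurgisserIkenmeyer2017, §7 (Appendix) Prop. 7.4 (3)] -/
theorem exists_lacunary_of_diagonal {f : MvPolynomial (Fin 2) ℂ} (hf : f.IsHomogeneous D)
    (hD : 2 ≤ D) {l μ : ℂ} (hl : l ≠ 0) (hμ : μ ≠ 0) (hlμ : l ≠ μ)
    (hT : linSubst (Fin 2) ℂ !![l, 0; 0, μ] f = f) :
    ∃ n r : ℕ, 2 ≤ n ∧ n ≤ D ∧ r < n ∧ ∀ e ∈ f.support, e 0 % n = r := by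
  classical
  have hdiag : !![l, 0; 0, μ] = Matrix.diagonal ![l, μ] := by
    ext i j
    fin_cases i <;> fin_cases j <;> simp
  have hdeg : ∀ e ∈ f.support, e 0 + e 1 = D := by
    intro e he
    have hd : e.degree = D := by
      rw [Finsupp.degree_eq_weight_one]
      exact hf (mem_support_iff.mp he)
    exact degIdx_fin_two_add D ⟨e, mem_degMonomials_iff.mpr hd⟩
  -- `λ^{e₀} μ^{e₁} = 1` on the support
  have key : ∀ e ∈ f.support, l ^ e 0 * μ ^ e 1 = 1 := by
    intro e he
    have h := congrArg (coeff e) hT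
    rw [hdiag, coeff_linSubst_diagonal_fin_two] at h
    simp only [Matrix.cons_val_zero, Matrix.cons_val_one] at h
    exact (mul_eq_right₀ (mem_support_iff.mp he)).mp h
  -- with `ω = λ/μ`: `ω^{e₀}` is constant on the support
  set ω : ℂ := l / μ with hω
  have hlω : l = ω * μ := by rw [hω, div_mul_cancel₀ _ hμ]
  have hω0 : ω ≠ 0 := div_ne_zero hl hμ
  have hω1 : ω ≠ 1 := by
    intro h
    apply hlμ
    rw [hlω, h, one_mul]
  have key' : ∀ e ∈ f.support, ω ^ e 0 * μ ^ D = 1 := by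
    intro e he
    have h := key e he
    rw [hlω, mul_pow, mul_assoc, ← pow_add, hdeg e he] at h
    exact h
  have hconst : ∀ e ∈ f.support, ∀ e' ∈ f.support, e 0 ≤ e' 0 → ω ^ (e' 0 - e 0) = 1 := by
    intro e he e' he' hle
    have h1 := key' e he
    have h2 := key' e' he'
    have h3 : ω ^ e 0 = ω ^ e' 0 :=
      mul_right_cancel₀ (pow_ne_zero D hμ) (h1.trans h2.symm)
    have h4 : ω ^ e 0 * ω ^ (e' 0 - e 0) = ω ^ e 0 * 1 := by
      rw [mul_one, ← pow_add, Nat.add_sub_cancel' hle, h3]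
    exact mul_left_cancel₀ (pow_ne_zero _ hω0) h4
  by_cases hex : ∃ e ∈ f.support, ∃ e' ∈ f.support, e 0 < e' 0
  · obtain ⟨e, he, e', he', hlt⟩ := hex
    set n := orderOf ω with hn
    have hdvd : n ∣ e' 0 - e 0 := orderOf_dvd_of_pow_eq_one (hconst e he e' he' hlt.le)
    have hn0 : n ≠ 0 := by
      intro h
      rw [h] at hdvd
      have := Nat.eq_zero_of_zero_dvd hdvd
      omega
    have hn1 : n ≠ 1 := by
      intro h
      exact hω1 (orderOf_eq_one_iff.mp h)
    have hnle : n ≤ e' 0 - e 0 := Nat.le_of_dvd (by omega) hdvd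
    have he'D : e' 0 ≤ D := by have := hdeg e' he'; omega
    refine ⟨n, e 0 % n, by omega, by omega, Nat.mod_lt _ (by omega), fun e'' he'' => ?_⟩
    rcases le_total (e 0) (e'' 0) with hle | hle
    · have hd : n ∣ e'' 0 - e 0 := orderOf_dvd_of_pow_eq_one (hconst e he e'' he'' hle)
      exact ((Nat.modEq_iff_dvd' hle).mpr hd).symm
    · have hd : n ∣ e 0 - e'' 0 := orderOf_dvd_of_pow_eq_one (hconst e'' he'' e he hle)
      exact (Nat.modEq_iff_dvd' hle).mpr hd
  · push Not at hex
    -- all `x₀`-exponents agree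
    have hall : ∀ e ∈ f.support, ∀ e' ∈ f.support, e 0 = e' 0 := fun e he e' he' =>
      le_antisymm (hex e' he' e he) (hex e he e' he')
    by_cases hne : f.support.Nonempty
    · obtain ⟨e₀, he₀⟩ := hne
      refine ⟨2, e₀ 0 % 2, le_rfl, hD, Nat.mod_lt _ two_pos, fun e he => ?_⟩
      rw [hall e he e₀ he₀]
    · refine ⟨2, 0, le_rfl, hD, two_pos, fun e he => absurd ⟨e, he⟩ hne⟩

/-- **Jordan-block stabilizer ⇒ pure power.** If `(λ b; 0 λ) · f = f` with `b ≠ 0`, `λ ≠ 0` for a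
binary form `f` of degree `D`, then `f = c x₀^D`: comparing the coefficients of the two lowest
powers of `x₀` gives `λ^D = 1` and then `(D - p₀) b λ^{D-1} c_{p₀} = 0`. (Step of the proof of BI 2017 App. Prop. 7.4 (3) given here; the
source omits that proof.) [cite: BurgisserIkenmeyer2017, §7 (Appendix) Prop. 7.4 (3)] -/
theorem apply_zero_eq_of_jordan {f : MvPolynomial (Fin 2) ℂ} (hf : f.IsHomogeneous D)
    {l b : ℂ} (hl : l ≠ 0) (hb : b ≠ 0) (hT : linSubst (Fin 2) ℂ !![l, b; 0, l] f = f) :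
    ∀ e ∈ f.support, e 0 = D := by
  classical
  -- coefficients along `x₀^p x₁^{D-p}`
  set c : ℕ → ℂ := fun p => coeff (binIdx D p).1 f with hc
  by_contra hcon
  push Not at hcon
  obtain ⟨e, he, heD⟩ := hcon
  have hdeg : e.degree = D := by
    rw [Finsupp.degree_eq_weight_one]
    exact hf (mem_support_iff.mp he)
  have he01 : e 0 + e 1 = D := degIdx_fin_two_add D ⟨e, mem_degMonomials_iff.mpr hdeg⟩
  have hce : c (e 0) ≠ 0 := by
    rw [hc]
    dsimp only
    rw [← eq_binIdx_of_degree hdeg]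
    exact mem_support_iff.mp he
  have hex : ∃ p, c p ≠ 0 := ⟨e 0, hce⟩
  set p₀ := Nat.find hex with hp₀
  have hp₀c : c p₀ ≠ 0 := Nat.find_spec hex
  have hmin : ∀ q < p₀, c q = 0 := fun q hq => by
    have := Nat.find_min hex hq
    simpa using this
  have hp₀e : p₀ ≤ e 0 := Nat.find_le hce
  have hp₀D : p₀ < D := lt_of_le_of_lt hp₀e (lt_of_le_of_ne (by omega) heD)
  have hβ : (!![l, b; 0, l] : Matrix (Fin 2) (Fin 2) ℂ) 1 0 = 0 := by simp
  have hβ00 : (!![l, b; 0, l] : Matrix (Fin 2) (Fin 2) ℂ) 0 0 = l := by simp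
  have hβ01 : (!![l, b; 0, l] : Matrix (Fin 2) (Fin 2) ℂ) 0 1 = b := by simp
  have hβ11 : (!![l, b; 0, l] : Matrix (Fin 2) (Fin 2) ℂ) 1 1 = l := by simp
  -- the coefficient of `x₀^{p₀} x₁^{D-p₀}`: `λ^D = 1`
  have hlD : l ^ D = 1 := by
    have h := congrArg (coeff (binIdx D p₀).1) hT
    rw [coeff_binIdx_linSubst_of_upper hf _ hβ hp₀D.le, hβ00, hβ01, hβ11,
      Finset.sum_eq_single p₀] at h
    · rw [if_pos le_rfl, Nat.sub_self, Nat.choose_zero_right, Nat.cast_one, one_mul, pow_zero,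
        mul_one, ← pow_add, Nat.add_sub_cancel' hp₀D.le] at h
      exact (mul_eq_left₀ hp₀c).mp h
    · intro q _ hq
      rcases lt_or_gt_of_ne hq with hlt | hgt
      · rw [show coeff (binIdx D q).1 f = c q from rfl, hmin q hlt, zero_mul]
      · rw [if_neg (not_le.mpr hgt), mul_zero]
    · intro h
      exfalso
      apply h
      rw [Finset.mem_range]
      omega
  -- the coefficient of `x₀^{p₀+1} x₁^{D-p₀-1}`
  have h := congrArg (coeff (binIdx D (p₀ + 1)).1) hT
  rw [coeff_binIdx_linSubst_of_upper hf _ hβ (by omega : p₀ + 1 ≤ D), hβ00, hβ01, hβ11,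
    Finset.sum_eq_add_of_mem p₀ (p₀ + 1) (by rw [Finset.mem_range]; omega)
      (by rw [Finset.mem_range]; omega) (by omega)] at h
  · rw [if_pos (Nat.le_succ _), if_pos le_rfl, Nat.sub_self, Nat.choose_zero_right,
      show p₀ + 1 - p₀ = 1 by omega, Nat.choose_one_right, pow_one, pow_zero, mul_one,
      Nat.cast_one, one_mul] at h
    have h2 : l ^ (p₀ + 1) * l ^ (D - (p₀ + 1)) = 1 := by
      rw [← pow_add, Nat.add_sub_cancel' (by omega : p₀ + 1 ≤ D), hlD]
    rw [h2, mul_one, add_eq_right] at h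
    -- `c p₀ * ((D - p₀) * l^{p₀} * b * l^{D-(p₀+1)}) = 0` is absurd
    have hDp : ((D - p₀ : ℕ) : ℂ) ≠ 0 := by
      rw [Nat.cast_ne_zero]
      omega
    apply hp₀c
    rcases mul_eq_zero.mp h with h' | h'
    · exact h'
    · exfalso
      apply mul_ne_zero (mul_ne_zero (mul_ne_zero hDp (pow_ne_zero _ hl)) hb) (pow_ne_zero _ hl) h'
  · intro q _ hq
    rcases Nat.lt_or_ge q p₀ with hlt | hge
    · rw [show coeff (binIdx D q).1 f = c q from rfl, hmin q hlt, zero_mul]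
    · have hq1 := hq.1
      have hq2 := hq.2
      rw [if_neg (by omega), mul_zero]

end Lacunary

/-! ### §5 Charts: a lacunary form after an invertible substitution -/

section Charts

variable {D : ℕ}

/-- A linear substitution of a binary form, expanded along `x₀^p x₁^{D-p}`:
`P · f = ∑_p c_p (P₀₀ x₀ + P₁₀ x₁)^p (P₀₁ x₀ + P₁₁ x₁)^{D-p}`. (Step of the proof of BI 2017 App. Prop. 7.4 (3) given here; the
source omits that proof.) [cite: BurgisserIkenmeyer2017, §7 (Appendix) Prop. 7.4 (3)] -/
theorem linSubst_eq_sum_binIdx {f : MvPolynomial (Fin 2) ℂ} (hf : f.IsHomogeneous D)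
    (P : Matrix (Fin 2) (Fin 2) ℂ) :
    linSubst (Fin 2) ℂ P f = ∑ p ∈ Finset.range (D + 1), C (coeff (binIdx D p).1 f) *
      (C (P 0 0) * X 0 + C (P 1 0) * X 1) ^ p * (C (P 0 1) * X 0 + C (P 1 1) * X 1) ^ (D - p) := by
  conv_lhs => rw [eq_sum_monomial_binIdx hf, map_sum]
  refine Finset.sum_congr rfl fun p hp => ?_
  rw [Finset.mem_range, Nat.lt_succ_iff] at hp
  have hmon : monomial (binIdx D p).1 (coeff (binIdx D p).1 f) =
      C (coeff (binIdx D p).1 f) * X 0 ^ p * X 1 ^ (D - p) := by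
    rw [monomial_eq, Finsupp.prod_fintype _ _ (fun i => pow_zero _), Fin.prod_univ_two,
      binIdx_apply_zero, binIdx_apply_one, min_eq_left hp, mul_assoc]
  rw [hmon, map_mul, map_mul, linSubst_C, map_pow, map_pow, linSubst_X, linSubst_X,
    Fin.sum_univ_two, Fin.sum_univ_two, smul_eq_C_mul, smul_eq_C_mul, smul_eq_C_mul, smul_eq_C_mul]

/-- Normalising a nonzero linear form `p x₀ + q x₁` so that its `x₀`-coefficient is `1` or `0`.
(Step of the proof of BI 2017 App. Prop. 7.4 (3) given here; the
source omits that proof.) [cite: BurgisserIkenmeyer2017, §7 (Appendix) Prop. 7.4 (3)] -/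
theorem exists_eq_smul_chart_left (p q : ℂ) (h : p ≠ 0 ∨ q ≠ 0) :
    ∃ (e : Bool) (t s : ℂ), s ≠ 0 ∧ (C p * X 0 + C q * X 1 : MvPolynomial (Fin 2) ℂ) =
      C s * (C (if e then 1 else 0) * X 0 + C (if e then t else 1) * X 1) := by
  by_cases hp : p = 0
  · have hq : q ≠ 0 := h.resolve_left (not_not.mpr hp)
    refine ⟨false, 0, q, hq, ?_⟩
    simp [hp]
  · refine ⟨true, q / p, p, hp, ?_⟩
    simp only [if_true, map_one, one_mul, mul_add]
    rw [← mul_assoc, ← map_mul, mul_div_cancel₀ _ hp]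

/-- Normalising a nonzero linear form `p x₀ + q x₁` so that its `x₁`-coefficient is `1` or `0`.
(Step of the proof of BI 2017 App. Prop. 7.4 (3) given here; the
source omits that proof.) [cite: BurgisserIkenmeyer2017, §7 (Appendix) Prop. 7.4 (3)] -/
theorem exists_eq_smul_chart_right (p q : ℂ) (h : p ≠ 0 ∨ q ≠ 0) :
    ∃ (e : Bool) (t s : ℂ), s ≠ 0 ∧ (C p * X 0 + C q * X 1 : MvPolynomial (Fin 2) ℂ) =
      C s * (C (if e then t else 1) * X 0 + C (if e then 1 else 0) * X 1) := by
  by_cases hq : q = 0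
  · have hp : p ≠ 0 := h.resolve_right (not_not.mpr hq)
    refine ⟨false, 0, p, hp, ?_⟩
    simp [hq]
  · refine ⟨true, p / q, q, hq, ?_⟩
    simp only [if_true, map_one, one_mul, mul_add]
    rw [← mul_assoc, ← map_mul, mul_div_cancel₀ _ hq]

/-- **The chart form of `P · f̃` for a lacunary `f̃`.** If all `x₀`-exponents of the binary form
`f̃` of degree `D` are `≡ r (mod n)` (`r < n`, `2 ≤ n ≤ D`) and `P` is invertible, then
`P · f̃ = ∑_j c_j u^{r+nj} v^{D-r-nj}` with `u, v` the normalised columns of `P` in one of four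
affine charts. (Step of the proof of BI 2017 App. Prop. 7.4 (3) given here; the
source omits that proof.) [cite: BurgisserIkenmeyer2017, §7 (Appendix) Prop. 7.4 (3)] -/
theorem exists_chart_of_lacunary {n r : ℕ} (hrn : r < n) (hnD : n ≤ D)
    {f : MvPolynomial (Fin 2) ℂ} (hf : f.IsHomogeneous D) (hlac : ∀ e ∈ f.support, e 0 % n = r)
    (P : Matrix (Fin 2) (Fin 2) ℂ) (hP : P.det ≠ 0) :
    ∃ (e₁ e₂ : Bool) (t₀ t₁ : ℂ) (c : Fin ((D - r) / n + 1) → ℂ),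
      linSubst (Fin 2) ℂ P f = ∑ j : Fin ((D - r) / n + 1), C (c j) *
        (C (if e₁ then 1 else 0) * X 0 + C (if e₁ then t₀ else 1) * X 1) ^ (r + n * j) *
        (C (if e₂ then t₁ else 1) * X 0 + C (if e₂ then 1 else 0) * X 1) ^ (D - (r + n * j)) := by
  classical
  have hn0 : 0 < n := by omega
  -- the two columns of `P` are nonzero
  have hcol0 : P 0 0 ≠ 0 ∨ P 1 0 ≠ 0 := by
    by_contra h
    push Not at h
    apply hP
    rw [Matrix.det_fin_two, h.1, h.2, zero_mul, mul_zero, sub_zero]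
  have hcol1 : P 0 1 ≠ 0 ∨ P 1 1 ≠ 0 := by
    by_contra h
    push Not at h
    apply hP
    rw [Matrix.det_fin_two, h.1, h.2, zero_mul, mul_zero, sub_zero]
  obtain ⟨e₁, t₀, s, hs, hu⟩ := exists_eq_smul_chart_left (P 0 0) (P 1 0) hcol0
  obtain ⟨e₂, t₁, s', hs', hv⟩ := exists_eq_smul_chart_right (P 0 1) (P 1 1) hcol1
  set u : MvPolynomial (Fin 2) ℂ :=
    C (if e₁ then 1 else 0) * X 0 + C (if e₁ then t₀ else 1) * X 1 with hu_def
  set v : MvPolynomial (Fin 2) ℂ :=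
    C (if e₂ then t₁ else 1) * X 0 + C (if e₂ then 1 else 0) * X 1 with hv_def
  set c' : ℕ → ℂ := fun p => coeff (binIdx D p).1 f with hc'
  -- coefficients off the progression `r + nℕ` vanish
  have hc'0 : ∀ p, p ≤ D → p % n ≠ r → c' p = 0 := by
    intro p hp hpr
    by_contra h
    have hmem : (binIdx D p).1 ∈ f.support := mem_support_iff.mpr h
    have := hlac _ hmem
    rw [binIdx_apply_zero, min_eq_left hp] at this
    exact hpr this
  refine ⟨e₁, e₂, t₀, t₁, fun j => c' (r + n * j) * s ^ (r + n * j) * s' ^ (D - (r + n * j)), ?_⟩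
  rw [linSubst_eq_sum_binIdx hf P, hu, hv]
  -- reindex the sum over the progression
  set g : ℕ → MvPolynomial (Fin 2) ℂ := fun p => C (c' p) * (C s * u) ^ p * (C s' * v) ^ (D - p)
    with hg
  set idx : Fin ((D - r) / n + 1) → ℕ := fun j => r + n * (j : ℕ) with hidx
  have himg : (Finset.univ : Finset (Fin ((D - r) / n + 1))).image idx ⊆
      Finset.range (D + 1) := by
    intro p hp
    rw [Finset.mem_image] at hp
    obtain ⟨j, -, rfl⟩ := hp
    rw [Finset.mem_range, Nat.lt_succ_iff, hidx]
    dsimp only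
    have hj : (j : ℕ) ≤ (D - r) / n := Nat.le_of_lt_succ j.2
    have : n * (j : ℕ) ≤ D - r := by
      have := Nat.mul_le_mul_left n hj
      exact this.trans (Nat.mul_div_le (D - r) n)
    omega
  have hsum : ∑ p ∈ Finset.range (D + 1), g p =
      ∑ p ∈ (Finset.univ : Finset (Fin ((D - r) / n + 1))).image idx, g p := by
    symm
    apply Finset.sum_subset himg
    intro p hp hpi
    rw [Finset.mem_range, Nat.lt_succ_iff] at hp
    have hpr : p % n ≠ r := by
      intro hpr'
      apply hpi
      rw [Finset.mem_image]
      have hdm := Nat.div_add_mod p n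
      rw [hpr'] at hdm
      have hp' : idx ⟨p / n, by
          rw [Nat.lt_succ_iff, Nat.le_div_iff_mul_le hn0, mul_comm]
          omega⟩ = p := by
        rw [hidx]
        dsimp only
        omega
      exact ⟨_, Finset.mem_univ _, hp'⟩
    rw [hg]
    dsimp only
    rw [hc'0 p hp hpr, C_0, zero_mul, zero_mul]
  have hinj : Set.InjOn idx ↑(Finset.univ : Finset (Fin ((D - r) / n + 1))) := by
    intro j₁ _ j₂ _ h
    apply Fin.ext
    rw [hidx] at h
    dsimp only at h
    exact Nat.eq_of_mul_eq_mul_left hn0 (Nat.add_left_cancel h)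
  have hsum2 : ∑ p ∈ (Finset.univ : Finset (Fin ((D - r) / n + 1))).image idx, g p =
      ∑ j : Fin ((D - r) / n + 1), g (idx j) := by
    rw [Finset.sum_image hinj]
  rw [show (∑ p ∈ Finset.range (D + 1), C (coeff (binIdx D p).1 f) * (C s * u) ^ p *
      (C s' * v) ^ (D - p)) = ∑ p ∈ Finset.range (D + 1), g p from rfl, hsum, hsum2]
  refine Finset.sum_congr rfl fun j _ => ?_
  rw [hidx]
  dsimp only
  rw [hg]
  dsimp only
  rw [mul_pow, mul_pow, ← map_pow, ← map_pow, map_mul, map_mul]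
  ring

end Charts

/-! ### §6 BI 2017 App. Prop. 7.4 (3): generic binary forms of degree `D ≥ 5` -/

section Main

/-- **BI 2017, Appendix Prop. 7.4 (3), PROVED** (main.tex L2933–2934, held text p0026:L68): "Let
`D ≥ 5`. The stabilizer of a generic `w ∈ Sym^D ℂ²` is trivial, hence `a'(D,2) = 1`" — for a
Zariski-generic binary form `f` of degree `D ≥ 5`, `stab(f) = {ζ I : ζ^D = 1}`
(`HasTrivialStabilizer`) and `a'(f) = 1` (`reducedStabilizerPeriod`). The genericity polynomial is
the product, over the finitely many lacunary families `(n, r)` (`2 ≤ n ≤ D`, `r < n`) and four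
charts, of a nonzero polynomial vanishing on the image of the corresponding `≤ D`-parameter family
(§1); the third clause of the named fact `BI2017_prop_A_4`, whose other two clauses (`D = 3, 4`)
are not proved here. [cite: BurgisserIkenmeyer2017, §7 (Appendix) Prop. 7.4 (3)] -/
theorem BI2017_prop_A_4_part3 (D : ℕ) (hD : 5 ≤ D) :
    IsZariskiGeneric D (fun f : MvPolynomial (Fin 2) ℂ =>
      HasTrivialStabilizer D f ∧ reducedStabilizerPeriod D f = 1) := by
  classical
  -- §1 applied to each chart family
  have hfam : ∀ (n r : ℕ) (e₁ e₂ : Bool), 2 ≤ n → r < n → n ≤ D →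
      ∃ Q : MvPolynomial (DegIdx (Fin 2) D) ℂ, Q ≠ 0 ∧
        ∀ (t₀ t₁ : ℂ) (c : Fin ((D - r) / n + 1) → ℂ),
          aeval (formCoeff D (∑ j : Fin ((D - r) / n + 1), C (c j) *
            (C (if e₁ then 1 else 0) * X 0 + C (if e₁ then t₀ else 1) * X 1) ^ (r + n * j) *
            (C (if e₂ then t₁ else 1) * X 0 + C (if e₂ then 1 else 0) * X 1) ^ (D - (r + n * j))))
            Q = 0 := by
    intro n r e₁ e₂ hn hrn hnD
    have hK : (D - r) / n + 1 + 2 < Fintype.card (DegIdx (Fin 2) D) := by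
      rw [card_degIdx_fin_two]
      have h1 : (D - r) / n ≤ D / 2 :=
        (Nat.div_le_div_left hn two_pos).trans (Nat.div_le_div_right (Nat.sub_le D r))
      omega
    -- the generic form of the family, coefficients in `ℂ[t₀, t₁, c]`
    obtain ⟨Q, hQ0, hQ⟩ := exists_ne_zero_aeval_formCoeff_map_eq_zero hK
      (∑ j : Fin ((D - r) / n + 1),
        C (X j.succ.succ : MvPolynomial (Fin ((D - r) / n + 1 + 2)) ℂ) *
          (C (if e₁ then 1 else 0) * X 0 +
              C (if e₁ then (X 0 : MvPolynomial (Fin ((D - r) / n + 1 + 2)) ℂ) else 1) * X 1) ^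
            (r + n * j) *
          (C (if e₂ then (X (Fin.succ 0) : MvPolynomial (Fin ((D - r) / n + 1 + 2)) ℂ) else 1) *
              X 0 + C (if e₂ then 1 else 0) * X 1) ^ (D - (r + n * j)))
    refine ⟨Q, hQ0, fun t₀ t₁ c => ?_⟩
    have h := hQ (Fin.cons t₀ (Fin.cons t₁ c))
    simp only [map_sum, map_mul, map_pow, map_add, map_C, map_X, eval_X, Fin.cons_succ,
      Fin.cons_zero, apply_ite (MvPolynomial.eval (Fin.cons t₀ (Fin.cons t₁ c) :
        Fin ((D - r) / n + 1 + 2) → ℂ)), map_one, map_zero] at h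
    exact h
  -- the genericity polynomial: product of the `Q`'s over all indices
  choose Q hQ0 hQ using hfam
  let Qf : ℕ → ℕ → Bool → Bool → MvPolynomial (DegIdx (Fin 2) D) ℂ := fun n r e₁ e₂ =>
    if h : 2 ≤ n ∧ r < n ∧ n ≤ D then Q n r e₁ e₂ h.1 h.2.1 h.2.2 else 1
  have hQf_pos : ∀ n r e₁ e₂ (hn : 2 ≤ n) (hrn : r < n) (hnD : n ≤ D),
      Qf n r e₁ e₂ = Q n r e₁ e₂ hn hrn hnD := by
    intro n r e₁ e₂ hn hrn hnD
    simp only [Qf, dif_pos (show 2 ≤ n ∧ r < n ∧ n ≤ D from ⟨hn, hrn, hnD⟩)]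
  have hQf0 : ∀ n r e₁ e₂, Qf n r e₁ e₂ ≠ 0 := by
    intro n r e₁ e₂
    by_cases h : 2 ≤ n ∧ r < n ∧ n ≤ D
    · rw [hQf_pos n r e₁ e₂ h.1 h.2.1 h.2.2]
      exact hQ0 n r e₁ e₂ h.1 h.2.1 h.2.2
    · simp only [Qf, dif_neg h]
      exact one_ne_zero
  let F : MvPolynomial (DegIdx (Fin 2) D) ℂ :=
    ∏ n ∈ Finset.range (D + 1), ∏ r ∈ Finset.range (D + 1), ∏ e₁ : Bool, ∏ e₂ : Bool, Qf n r e₁ e₂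
  have hF0 : F ≠ 0 := by
    refine Finset.prod_ne_zero_iff.mpr fun n _ => Finset.prod_ne_zero_iff.mpr fun r _ =>
      Finset.prod_ne_zero_iff.mpr fun e₁ _ => Finset.prod_ne_zero_iff.mpr fun e₂ _ => hQf0 n r e₁ e₂
  refine ⟨F, hF0, fun f hf hFf => ?_⟩
  -- off the zero set of `F`, `f` is in no chart family
  have hnot : ∀ (n r : ℕ) (e₁ e₂ : Bool), 2 ≤ n → r < n → n ≤ D →
      ∀ (t₀ t₁ : ℂ) (c : Fin ((D - r) / n + 1) → ℂ),
        f ≠ ∑ j : Fin ((D - r) / n + 1), C (c j) *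
            (C (if e₁ then 1 else 0) * X 0 + C (if e₁ then t₀ else 1) * X 1) ^ (r + n * j) *
            (C (if e₂ then t₁ else 1) * X 0 + C (if e₂ then 1 else 0) * X 1) ^ (D - (r + n * j)) := by
    intro n r e₁ e₂ hn hrn hnD t₀ t₁ c heq
    apply hFf
    have hdvd : Qf n r e₁ e₂ ∣ F := by
      have h1 : Qf n r e₁ e₂ ∣ ∏ e₂' : Bool, Qf n r e₁ e₂' :=
        Finset.dvd_prod_of_mem (fun e₂' => Qf n r e₁ e₂') (Finset.mem_univ e₂)
      have h2 : (∏ e₂' : Bool, Qf n r e₁ e₂') ∣ ∏ e₁' : Bool, ∏ e₂' : Bool, Qf n r e₁' e₂' :=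
        Finset.dvd_prod_of_mem (fun e₁' => ∏ e₂' : Bool, Qf n r e₁' e₂') (Finset.mem_univ e₁)
      have h3 : (∏ e₁' : Bool, ∏ e₂' : Bool, Qf n r e₁' e₂') ∣
          ∏ r' ∈ Finset.range (D + 1), ∏ e₁' : Bool, ∏ e₂' : Bool, Qf n r' e₁' e₂' :=
        Finset.dvd_prod_of_mem (fun r' => ∏ e₁' : Bool, ∏ e₂' : Bool, Qf n r' e₁' e₂')
          (Finset.mem_range.mpr (by omega))
      have h4 : (∏ r' ∈ Finset.range (D + 1), ∏ e₁' : Bool, ∏ e₂' : Bool, Qf n r' e₁' e₂') ∣ F :=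
        Finset.dvd_prod_of_mem (fun n' => ∏ r' ∈ Finset.range (D + 1), ∏ e₁' : Bool,
          ∏ e₂' : Bool, Qf n' r' e₁' e₂') (Finset.mem_range.mpr (by omega))
      exact h1.trans (h2.trans (h3.trans h4))
    obtain ⟨R, hR⟩ := hdvd
    have hQ' : aeval (formCoeff D f) (Qf n r e₁ e₂) = 0 := by
      have hspec := hQ n r e₁ e₂ hn hrn hnD t₀ t₁ c
      rw [← heq] at hspec
      rw [hQf_pos n r e₁ e₂ hn hrn hnD]
      exact hspec
    rw [hR, map_mul, hQ', zero_mul]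
  have hD2 : 2 ≤ D := by omega
  -- `f ≠ 0` (the zero form lies in every family)
  have hf0 : f ≠ 0 := by
    intro h0
    apply hnot 2 0 false false le_rfl two_pos hD2 0 0 (fun _ => 0)
    rw [h0]
    simp
  -- every stabilizer element is a scalar `ζ I` with `ζ^D = 1`
  have htriv : HasTrivialStabilizer D f := by
    intro γ hγ
    rw [mem_linStabilizer, linSubstRep_apply] at hγ
    by_contra hne
    push Not at hne
    have hns : ∀ cst : ℂ, (γ : Matrix (Fin 2) (Fin 2) ℂ) ≠ cst • (1 : Matrix (Fin 2) (Fin 2) ℂ) := by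
      intro cst hc
      apply hne cst _ hc
      rw [hc, linSubst_smul_one_fin_two hf] at hγ
      have h1 : (cst ^ D - 1) • f = 0 := by rw [sub_smul, one_smul, hγ, sub_self]
      rcases smul_eq_zero.mp h1 with h2 | h2
      · exact sub_eq_zero.mp h2
      · exact absurd h2 hf0
    obtain ⟨P, l, μ, b, hP, hgP, hb1, hb2⟩ :=
      exists_mul_eq_mul_upperTriangular (γ : Matrix (Fin 2) (Fin 2) ℂ) hns
    obtain ⟨hTf, hPf⟩ := linSubst_inv_of_mul_eq_mul hP hgP hγ
    set g := linSubst (Fin 2) ℂ P⁻¹ f with hg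
    have hg_hom : g.IsHomogeneous D := linSubst_isHomogeneous _ hf
    -- `λ μ = det γ ≠ 0`
    have hlμ : l * μ ≠ 0 := by
      have hdet := congrArg Matrix.det hgP
      rw [Matrix.det_mul, Matrix.det_mul, Matrix.det_fin_two_of, mul_comm] at hdet
      have hγdet : (γ : Matrix (Fin 2) (Fin 2) ℂ).det ≠ 0 :=
        (Matrix.isUnits_det_units γ).ne_zero
      have h2 : l * μ - b * 0 = (γ : Matrix (Fin 2) (Fin 2) ℂ).det := mul_left_cancel₀ hP hdet.symm
      rw [mul_zero, sub_zero] at h2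
      rw [h2]
      exact hγdet
    have hl : l ≠ 0 := left_ne_zero_of_mul hlμ
    have hμ : μ ≠ 0 := right_ne_zero_of_mul hlμ
    -- `g` is lacunary
    obtain ⟨n, r, hn2, hnD, hrn, hlac⟩ :
        ∃ n r : ℕ, 2 ≤ n ∧ n ≤ D ∧ r < n ∧ ∀ e ∈ g.support, e 0 % n = r := by
      by_cases hlm : l = μ
      · have hb := hb1 hlm
        rw [← hlm] at hTf
        refine ⟨2, D % 2, le_rfl, hD2, Nat.mod_lt _ two_pos, fun e he => ?_⟩
        rw [apply_zero_eq_of_jordan hg_hom hl hb hTf e he]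
      · have hb := hb2 hlm
        rw [hb] at hTf
        exact exists_lacunary_of_diagonal hg_hom hD2 hl hμ hlm hTf
    obtain ⟨e₁, e₂, t₀, t₁, c, hchart⟩ := exists_chart_of_lacunary hrn hnD hg_hom hlac P hP
    exact hnot n r e₁ e₂ hn2 hrn hnD t₀ t₁ c (by rw [← hPf, hchart])
  exact ⟨htriv, reducedStabilizerPeriod_eq_one_of_hasTrivialStabilizer hf (by omega) htriv⟩

end Main

/-! ### §7 Genericity by dimension count (reusable form of §1 + §6) -/

section Cover

/-- **Genericity by dimension count.** Let `P` be a property of forms of degree `D` in `m`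
variables. Suppose every form of degree `D` failing `P` lies in the image of one of finitely many
polynomial families `Gᵢ` (forms whose coefficients are polynomials in `aᵢ` parameters), each with
fewer parameters than `dim Sym^D ℂ^m`. Then `P` holds for Zariski-generic forms: the product of the
nonzero polynomials of §1 vanishing on the images is the genericity polynomial. (The classical
dimension-count argument behind generic-stabilizer statements such as BI 2017 Thm. 2.3 / App.
Prop. 7.4; here for the tree's `IsZariskiGeneric`.)
[cite: BurgisserIkenmeyer2017, §7 (Appendix) Prop. 7.4 (3)] -/
theorem isZariskiGeneric_of_forall_exists_map_eval {m D : ℕ} {P : MvPolynomial (Fin m) ℂ → Prop}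
    {ι : Type*} [Fintype ι] (a : ι → ℕ) (ha : ∀ i, a i < Fintype.card (DegIdx (Fin m) D))
    (G : ∀ i, MvPolynomial (Fin m) (MvPolynomial (Fin (a i)) ℂ))
    (hP : ∀ f : MvPolynomial (Fin m) ℂ, f.IsHomogeneous D → ¬ P f →
      ∃ (i : ι) (t : Fin (a i) → ℂ), f = MvPolynomial.map (MvPolynomial.eval t) (G i)) :
    IsZariskiGeneric D P := by
  classical
  have hQ : ∀ i, ∃ Q : MvPolynomial (DegIdx (Fin m) D) ℂ, Q ≠ 0 ∧
      ∀ t : Fin (a i) → ℂ, aeval (formCoeff D (MvPolynomial.map (MvPolynomial.eval t) (G i))) Q = 0 :=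
    fun i => exists_ne_zero_aeval_formCoeff_map_eq_zero (ha i) (G i)
  choose Q hQ0 hQ using hQ
  refine ⟨∏ i, Q i, Finset.prod_ne_zero_iff.mpr fun i _ => hQ0 i, fun f hf hFf => ?_⟩
  by_contra hPf
  obtain ⟨i, t, rfl⟩ := hP f hf hPf
  apply hFf
  rw [map_prod]
  exact Finset.prod_eq_zero (Finset.mem_univ i) (hQ i t)

end Cover

end Literature.Computability.AlgebraicComplexity
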